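import Summits.HubbardSuperconductivity.HubbardSuperconductivity.Theorems.AnisotropyChordTransferFibre3MasterInequality
import Summits.HubbardSuperconductivity.HubbardSuperconductivity.Theorems.AnisotropyChordTransferFibre3ParsevalSplit
import Summits.HubbardSuperconductivity.HubbardSuperconductivity.Theorems.AnisotropyChordTransferFibre3GroundState

/-!
# Route `AnisotropyChord` / H0 rotor rung: THE PARAMETRISED ASSEMBLY `KTAssemblyAbs` IS A THEOREM

Memo ROTOR-THEORY-21 §301 (theory seat `hubbard-h0-rotor-theory-1`, PartN31 = `…Fibre3BetaFreeTargets`):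
**`ktAssemblyAbs_holds : KTAssemblyAbs L Δ c a b ρ`** for ALL parameters — i.e. for `8 ≤ L`, `0 < Δ < 1`, `0 < ρ`, a ground
two-magnon profile with `T⁺ < 2ε₁`, `0 < m` and the arithmetic side condition `fac·η_eff·(a + b/ρ) < c`, the three β-free
cruxes (KT-1″) `TrialGapAbs c`, (KT-2a″) `LowShellGFormAbs a`, (KT-2b″) `OffPoleTailAbs b` together with `DenMinRest ρ` and
`L2Quant` imply `GM3Fibre L Δ`.
Chain: STEP 0 `T* := T⁺ > 0` (`Tplus_pos`), third check = the admissible product state `Π⁰` itself (`prodState_admissible`);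
STEP 1 `Q̃(T⁺) ≻ 0` from `L2Quant` (`ĝ₀ > 0`); STEP 2 the master inequality (`master_inequality_hom` with `ĝ = ĝ₀`, applied to
`Ψ¹ = vΠ⁰`, `⟨v,Ψ¹⟩ ≠ 0` by `ip_vfun_trialK1_ne_zero`); STEP 3 the low/rest split (`re_Gform_le_split` with `m = ρ(2ε₁ − T⁺)`);
STEP 4 arithmetic; then `gm3Fibre_of_checks`.
Prover seat `hubbard-h0-rotor-p1` g22; helper for stmt-HubbardSuperconductivity-19089 (`--supports`).
-/

set_option linter.dupNamespace false
set_option autoImplicit false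

noncomputable section

open scoped BigOperators
open Complex Matrix

namespace Summit.HubbardSuperconductivity.HubbardSuperconductivity.Theorems.AnisotropyChord.Transfer.Fibre3

variable (L : ℕ) [NeZero L]

/-! ## The `K₁` trial state is admissible-shaped -/

/-- `Ψ¹ = vΠ⁰` is symmetric in the `K₁` fibre (evenness of `f`; `v` is symmetric). [folklore] -/
theorem isSymm_trialK1 {Δ lam2 : ℝ} {f : Tor L → ℝ} (hf : IsGroundTwoMagnon L Δ lam2 f) :
    IsSymm L (K1 L) (trialK1 L f) := by
  have heven : ∀ r, f (-r) = f r := hf.2.1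
  obtain ⟨hv1, hv2⟩ := isSymm_vfun L
  constructor
  · intro c
    unfold trialK1
    rw [hv1 c, prodState_apply, prodState_apply]
    have : f (c.1 - c.2) = f (c.2 - c.1) := by rw [← heven (c.2 - c.1), neg_sub]
    simp only
    rw [this]; push_cast; ring
  · intro c
    unfold trialK1
    rw [← hv2 c, prodState_apply, prodState_apply]
    simp only
    rw [heven c.1, show c.2 - c.1 - -c.1 = c.2 by abel]
    push_cast; ring

/-- `Ψ¹` vanishes on the hard core. [folklore] -/
theorem trialK1_D {Δ lam2 : ℝ} {f : Tor L → ℝ} (hf : IsGroundTwoMagnon L Δ lam2 f) (c : Cfg L) (hc : InD L c = true) :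
    trialK1 L f c = 0 := by
  unfold trialK1; rw [prodState_D L hf c hc, mul_zero]

/-! ## Bookkeeping identities -/

/-- the trial-gap numerator `N₁` is the energy form of the master inequality at `T = T⁺`. [folklore] -/
theorem trialGapN1_eq (Δ : ℝ) (f : Tor L → ℝ) :
    trialGapN1 L Δ f
      = (ip L (trialK1 L f) (fun c => Happly L (K1 L) Δ (trialK1 L f) c
          - ((eps1 L + Tplus L Δ f : ℝ) : ℂ) * trialK1 L f c)).re := by
  unfold trialGapN1
  rw [ip_sub_right, Complex.sub_re]
  congr 1
  have : ip L (trialK1 L f) (fun c => ((eps1 L + Tplus L Δ f : ℝ) : ℂ) * trialK1 L f c)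
      = ((eps1 L + Tplus L Δ f : ℝ) : ℂ) * ip L (trialK1 L f) (trialK1 L f) := by
    unfold ip; rw [Finset.mul_sum]; refine Finset.sum_congr rfl fun c _ => ?_; ring
  rw [this, Complex.re_ofReal_mul]

/-- a nonzero shell vector has positive weighted norm. [folklore] -/
theorem shell_weighted_sum_pos {Δ : ℝ} (hΔ : 0 < Δ) {y : Ssub L → ℂ} (hy : y ≠ 0) :
    0 < ∑ s : Ssub L, ‖y s‖ ^ 2 / (Δ * (Wcount L s.1 : ℝ)) := by
  obtain ⟨s, hs'⟩ := Function.ne_iff.mp hy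
  have hs : y s ≠ 0 := by simpa using hs'
  apply Finset.sum_pos'
  · intro s' _
    have := Wcount_pos_of_InS L s'.2
    positivity
  · refine ⟨s, Finset.mem_univ _, ?_⟩
    have hW := Wcount_pos_of_InS L s.2
    have : (0 : ℝ) < Wcount L s.1 := by exact_mod_cast hW
    have hn : 0 < ‖y s‖ := norm_pos_iff.mpr hs
    positivity

/-! ## The assembly -/

/-- **THE PARAMETRISED ASSEMBLY HOLDS:** `KTAssemblyAbs L Δ c a b ρ` for every `L, Δ, c, a, b, ρ`
(memo 21 §301 STEPS 0–4 + `gm3Fibre_of_checks`). [folklore] -/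
theorem ktAssemblyAbs_holds (Δ c a b ρ : ℝ) : KTAssemblyAbs L Δ c a b ρ := by
  intro hL8 hΔ0 hΔ1 hρ hex hKT1 hKT2a hKT2b hden hL2Q
  obtain ⟨lam2, f, hf, hT2, hm, hside⟩ := hex
  have hL4 : 4 ≤ L := by omega
  have hL2 : 2 ≤ L := by omega
  have hε := eps1_pos L hL4
  set T := Tplus L Δ f with hT
  have hT0 : 0 < T := Tplus_pos L hL2 hΔ1 hf
  have hg0 : 0 < 2 * eps1 L - T := by linarith
  -- STEP 1: shell positivity at T⁺ from L2Quant
  have hĝ : 0 < g0hat L Δ f := by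
    unfold g0hat
    apply div_pos <;> [nlinarith; linarith]
  have hcoer : ∀ y : Ssub L → ℂ, g0hat L Δ f * ∑ s : Ssub L, ‖y s‖ ^ 2 / (Δ * (Wcount L s.1 : ℝ))
      ≤ (star y ⬝ᵥ Qtilde L T Δ *ᵥ y).re := fun y => hL2Q lam2 f hf y
  have hQ : ∀ y : Ssub L → ℂ, y ≠ 0 → 0 < (star y ⬝ᵥ Qtilde L T Δ *ᵥ y).re := by
    intro y hy
    have h1 := hcoer y
    have h2 := shell_weighted_sum_pos L hΔ0 hy
    have := mul_pos hĝ h2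
    linarith
  -- STEP 2: the master inequality for Ψ¹
  set Ψ := trialK1 L f with hΨ
  have hsym := isSymm_trialK1 L hf
  have hD := trialK1_D L hf
  have hβ := ip_vfun_trialK1_ne_zero L hL2 hf
  have hE : 0 ≤ eps1 L + T := by linarith
  have hMI := master_inequality_hom L hL4 hΔ0 hE hT2 (g0hat L Δ f) hĝ hcoer Ψ hsym hD hβ
  -- names for the quantities
  set N := trialGapN1 L Δ f with hN
  have hNeq := trialGapN1_eq L Δ f
  set R := resid L Δ f with hR
  have hReq : R = residual L T Δ Ψ := rfl
  set G := (Gform L T R R).re with hG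
  set U := Uunit L Δ f with hU
  set η := etaEff L lam2 with hη
  set fac := facMI L Δ f with hfac
  have hfac_eq : fac = 1 + (3 * eps1 L / (2 * eps1 L - T)) * Δ / g0hat L Δ f := rfl
  have hU0 : 0 < U := by
    rw [hU]; unfold Uunit
    have : (0 : ℝ) < L := by exact_mod_cast (show 0 < L by omega)
    positivity
  have hκ : 0 ≤ 3 * eps1 L / (2 * eps1 L - T) := div_nonneg (by linarith) hg0.le
  have hfac0 : 0 ≤ fac := by
    rw [hfac_eq]
    have : 0 ≤ (3 * eps1 L / (2 * eps1 L - T)) * Δ / g0hat L Δ f := by positivity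
    linarith
  rw [← hNeq, ← hReq, ← hfac_eq] at hMI
  -- hMI : N − fac·G ≤ ‖⟨v,Ψ⟩‖²/(3V²)·(Φ(T) − T)
  -- STEP 3: the low/rest split
  have hm : 0 < ρ * (2 * eps1 L - T) := mul_pos hρ hg0
  have hsplit := re_Gform_le_split L hL4 T R hm (fun k₂ k₃ hp hl => hden lam2 f hf k₂ k₃ hp hl)
  -- the crux bounds
  have h1 : c * U ≤ N := hKT1 lam2 f hf
  have h2 : lowGForm L Δ f ≤ a * η * U := hKT2a lam2 f hf
  have h3 : (ip L R R).re - polePart L Δ f - lowNormPart L Δ f ≤ b * η * (2 * eps1 L - T) * U := hKT2b lam2 f hf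
  have hsplit' : G ≤ lowGForm L Δ f + ((ip L R R).re - polePart L Δ f - lowNormPart L Δ f) / (ρ * (2 * eps1 L - T)) := by
    rw [hG]; unfold lowGForm polePart lowNormPart; exact hsplit
  have h4 : ((ip L R R).re - polePart L Δ f - lowNormPart L Δ f) / (ρ * (2 * eps1 L - T)) ≤ b * η * U / ρ := by
    rw [div_le_iff₀ hm]
    calc (ip L R R).re - polePart L Δ f - lowNormPart L Δ f ≤ b * η * (2 * eps1 L - T) * U := h3
      _ = b * η * U / ρ * (ρ * (2 * eps1 L - T)) := by field_simp
  have h5 : G ≤ η * U * (a + b / ρ) := by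
    have : a * η * U + b * η * U / ρ = η * U * (a + b / ρ) := by ring
    linarith [hsplit', h2, h4]
  -- STEP 4: arithmetic
  have h6 : fac * G ≤ fac * (η * U * (a + b / ρ)) := mul_le_mul_of_nonneg_left h5 hfac0
  have hpos : 0 < N - fac * G := by
    have hside' : fac * η * (a + b / ρ) * U < c * U := mul_lt_mul_of_pos_right hside hU0
    nlinarith [h1, h6, hside']
  -- conclude Φ(T⁺) > T⁺
  have hβpos : 0 < ‖ip L (vfun L) Ψ‖ ^ 2 / (3 * ((L : ℝ) ^ 2) ^ 2) := by
    have : 0 < ‖ip L (vfun L) Ψ‖ := norm_pos_iff.mpr hβ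
    have hLpos : (0 : ℝ) < L := by exact_mod_cast (show 0 < L by omega)
    positivity
  have hPhi : T < Phi L T Δ := by
    by_contra h
    have h' : Phi L T Δ - T ≤ 0 := by linarith
    have := mul_nonpos_of_nonneg_of_nonpos hβpos.le h'
    linarith [hMI]
  -- the three checks of the certificate
  exact gm3Fibre_of_checks L hL4 hΔ0.ne' T hT2 hQ hPhi ⟨prodState L f, prodState_admissible L hL2 hf, le_rfl⟩

end Summit.HubbardSuperconductivity.HubbardSuperconductivity.Theorems.AnisotropyChord.Transfer.Fibre3

end
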